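import Mathlib
import HarnessLib
import Literature.Computability.Complexity.GraphEncodings
import Literature.Computability.Complexity.Classes
import Literature.Computability.Complexity.CodeFPStrings
import Literature.Computability.Complexity.CodeFPStringKit
import Literature.Computability.Complexity.CodeFPLists
import Literature.Computability.Complexity.CodeFPArith
import Literature.Computability.Complexity.LengthCompare

/-!
# `SymmetryBudget.WindowBarrier`, line `canonical-form-completeness` — header bricks (stub S2)

Route `PneNP/SymmetryBudget`, crux `stmt-PneNP-2145`
(`Summit.PneNP.PneNP.Theses.SymmetryBudget.WindowBarrier`), line `canonical-form-completeness`,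
stub `stub_addressableBitLanguage` (S2, "header addressing"): a complete invariant `F ∈ FP` for
`Bud(m,⌊log₂ m⌋)`-isomorphism of graph codes is turned into ONE bit language in `P` whose graph
slices are `Bud`-invariant and which separates header-agreeing non-isomorphic pairs after a
common overwrite of the header block `{(u,v) : u, v < t m}`. This file holds the VOCABULARY and
the polynomial-time half; the stub itself is
`SymmetryBudgetWindowBarrierStubAddressableBitLanguage.lean`.

* Matrices `x : Fin m × Fin m → Bool`, their graphs `Gr x` (verbatim the route's inline `Gr`:
  `SimpleGraph.fromRel fun u v => x (u, v) = true`), diagonal relabelling `rel ρ x = x ∘ (ρ × ρ)`,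
  header overwrite `ovw t h x` (verbatim the `if q.1 < t ∧ q.2 < t then h q else x q` of the
  stub), the header matrix `hdrOf Q` writing a bit string into row `0`; the row-major adjacency
  bits `adjBits G` (the payload of `encodingGraph.encode ⟨m, G⟩ = ⟨bin m, adjBits G⟩`), and the
  facts the stub rests on: clearing the header block of the CODE is the code of the cleared
  MATRIX (`clearStr_adjBits`); header bits are invariant under header-fixing relabellings
  (`adjBits_rel_getElem`) and freely writable through `hdrOf` (`adjBits_ovw_hdrOf_getElem`);
  non-isomorphism survives clearing (`gr_rel_eq_of_cleared`).
* The decision map `pFun F A B m₁ : List Bool → Bool` — parse `w = ⟨bin m, bits⟩` (`fstF`/`sndF`),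
  reject `m < m₁`, read the query (type bit `bits[1]`, address `⟦bits[2 … t-1]⟧`,
  `t = hdr A B m = A·|bin m| + B + 2`) off row `0` of the adjacency matrix, clear the header block
  (`clearStr`), apply `F`, answer `a < |u|` (type `0`) / `a < |u| ∧ u[a] = 1` (type `1`) — and
  its language `lang F A B m₁ ∈ P` (`lang_mem_P`), assembled in the tree's typed calculus of
  polynomial-time maps on codes (`CodeFP`: `mapIdx`, `natDiv`, `natMod`, `strGetD`,
  `codeFP_hdrBody`, …; no machine is written here).

`Gr`/`rel` restate `Gr`/`relabel` of the refuter's `Cruxes/WindowBarrier/Disproof.lean`, which a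
Theorems file may not import. References: S. Arora, B. Barak, *Computational Complexity: A Modern
Approach*, CUP 2009, §1.3 (closure of polynomial time), §0.1 (codes); the line's skeleton.
-/

-- `Summit.PneNP.PneNP.…` duplicates `PneNP` BY DESIGN (single-problem summit, D-0017).
set_option linter.dupNamespace false

namespace Summit.PneNP.PneNP.Theorems.AddressableBitLanguage

open Literature.Computability.Complexity _root_.Computability
open scoped Classical

variable {m : ℕ}

/-! ### Matrices, their graphs, relabelling and header overwrites -/

/-- The graph of an `m × m` Boolean matrix (the route's inline `Gr`: symmetrised, loops dropped).
[folklore] -/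
def Gr (x : Fin m × Fin m → Bool) : SimpleGraph (Fin m) :=
  SimpleGraph.fromRel fun u v => x (u, v) = true

/-- Diagonal relabelling `x ∘ (ρ × ρ)`. [folklore] -/
def rel (ρ : Equiv.Perm (Fin m)) (x : Fin m × Fin m → Bool) : Fin m × Fin m → Bool :=
  fun q => x (ρ q.1, ρ q.2)

/-- Header overwrite: the block `{(u,v) : u, v < t}` of `x` is replaced by that of `h`. [folklore] -/
def ovw (t : ℕ) (h x : Fin m × Fin m → Bool) : Fin m × Fin m → Bool :=
  fun q => if (q.1 : ℕ) < t ∧ (q.2 : ℕ) < t then h q else x q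

/-- The header matrix writing the bit string `Q` into row `0`: `(0, k) ↦ Q k`, all other entries
`0`. [folklore] -/
def hdrOf (Q : ℕ → Bool) : Fin m × Fin m → Bool :=
  fun q => if (q.1 : ℕ) = 0 then Q q.2 else false

/-- Adjacency in the graph of a matrix. [folklore] -/
theorem gr_adj (x : Fin m × Fin m → Bool) (u v : Fin m) :
    (Gr x).Adj u v ↔ u ≠ v ∧ (x (u, v) = true ∨ x (v, u) = true) :=
  SimpleGraph.fromRel_adj _ _ _

/-- Adjacency in the graph of a relabelled matrix. [folklore] -/
theorem gr_rel_adj (ρ : Equiv.Perm (Fin m)) (x : Fin m × Fin m → Bool) (u v : Fin m) :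
    (Gr (rel ρ x)).Adj u v ↔ (Gr x).Adj (ρ u) (ρ v) := by
  rw [gr_adj, gr_adj, ρ.injective.ne_iff]
  rfl

section Fix

variable {t : ℕ} {ρ : Equiv.Perm (Fin m)}

/-- A permutation fixing the header points preserves "being a header point". [folklore] -/
theorem lt_iff_of_fix (hfix : ∀ i : Fin m, (i : ℕ) < t → ρ i = i) (i : Fin m) :
    ((ρ i : Fin m) : ℕ) < t ↔ (i : ℕ) < t := by
  constructor
  · intro h
    have h1 : ρ (ρ i) = ρ i := hfix (ρ i) h
    rw [ρ.injective h1] at h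
    exact h
  · intro h
    rw [hfix i h]
    exact h

/-- Clearing the header commutes with a header-fixing relabelling. [folklore] -/
theorem ovw_false_rel (hfix : ∀ i : Fin m, (i : ℕ) < t → ρ i = i) (x : Fin m × Fin m → Bool) :
    ovw t (fun _ => false) (rel ρ x) = rel ρ (ovw t (fun _ => false) x) := by
  funext q
  simp only [ovw, rel, lt_iff_of_fix hfix]

/-- **Non-isomorphism survives clearing**: if a header-fixing `ρ` carries the cleared `x` onto the
cleared `y` and `x, y` agree on the header block, then `ρ` carries `x` onto `y`. [folklore] -/
theorem gr_rel_eq_of_cleared (hfix : ∀ i : Fin m, (i : ℕ) < t → ρ i = i)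
    (x y : Fin m × Fin m → Bool)
    (hagree : ∀ q : Fin m × Fin m, (q.1 : ℕ) < t → (q.2 : ℕ) < t → x q = y q)
    (h : Gr (rel ρ (ovw t (fun _ => false) x)) = Gr (ovw t (fun _ => false) y)) :
    Gr (rel ρ x) = Gr y := by
  ext u v
  have huv : (Gr (rel ρ (ovw t (fun _ => false) x))).Adj u v ↔
      (Gr (ovw t (fun _ => false) y)).Adj u v := by rw [h]
  rw [gr_rel_adj, gr_adj, gr_adj] at huv ⊢
  by_cases hc : (u : ℕ) < t ∧ (v : ℕ) < t
  · rw [hfix u hc.1, hfix v hc.2, hagree (u, v) hc.1 hc.2, hagree (v, u) hc.2 hc.1]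
  · have hc' : ¬ ((v : ℕ) < t ∧ (u : ℕ) < t) := fun h' => hc ⟨h'.2, h'.1⟩
    have hρ : ¬ (((ρ u : Fin m) : ℕ) < t ∧ ((ρ v : Fin m) : ℕ) < t) := by
      rwa [lt_iff_of_fix hfix, lt_iff_of_fix hfix]
    have hρ' : ¬ (((ρ v : Fin m) : ℕ) < t ∧ ((ρ u : Fin m) : ℕ) < t) := fun h' => hρ ⟨h'.2, h'.1⟩
    simpa only [ovw, if_neg hc, if_neg hc', if_neg hρ, if_neg hρ'] using huv

end Fix

/-- Clearing after any overwrite is clearing. [folklore] -/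
theorem ovw_false_ovw (t : ℕ) (h x : Fin m × Fin m → Bool) :
    ovw t (fun _ => false) (ovw t h x) = ovw t (fun _ => false) x := by
  funext q
  by_cases hc : (q.1 : ℕ) < t ∧ (q.2 : ℕ) < t <;> simp [ovw, hc]

/-! ### Adjacency bits (the payload of a graph code) -/

/-- One bit of the header-clearing map: position `i` of a row-major `m × m` bit matrix is zeroed
when both its row `i / m` and its column `i % m` are below `t`. [folklore] -/
def clearBit (m t i : ℕ) (b : Bool) : Bool :=
  b && !(decide (i / m < t) && decide (i % m < t))

/-- Clearing the header block `{(u,v) : u, v < t}` of a row-major `m × m` bit matrix. [folklore] -/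
def clearStr (m t : ℕ) (bits : List Bool) : List Bool :=
  bits.mapIdx fun i b => clearBit m t i b

/-- The row-major adjacency bits of a graph on `Fin m` (the payload of its code). [folklore] -/
noncomputable def adjBits (G : SimpleGraph (Fin m)) : List Bool := (encodingGraphFin m).encode G

/-- The code of `⟨m, G⟩` is `⟨bin m, adjBits G⟩`. [folklore] -/
theorem encode_eq (G : SimpleGraph (Fin m)) :
    encodingGraph.encode ⟨m, G⟩ = boolPair (encodeNat m) (adjBits G) := rfl

/-- There are `m²` adjacency bits. [folklore] -/
@[simp] theorem length_adjBits (G : SimpleGraph (Fin m)) : (adjBits G).length = m * m := by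
  simp [adjBits, encodingGraphFin, encodingBitVec]

/-- Bit `k` is the adjacency of row `k / m` and column `k % m`. [folklore] -/
theorem adjBits_getElem (G : SimpleGraph (Fin m)) {k : ℕ} (hk : k < (adjBits G).length) :
    (adjBits G)[k] = true ↔
      G.Adj ⟨k / m, Nat.div_lt_of_lt_mul (by simpa using hk)⟩
        ⟨k % m, Nat.mod_lt _ (Nat.pos_of_ne_zero fun h => by simp [h] at hk)⟩ := by
  have hk' : k < m * m := by simpa using hk
  have h : (adjBits G)[k] = decide (G.Adj (finProdFinEquiv.symm ⟨k, hk'⟩).1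
      (finProdFinEquiv.symm ⟨k, hk'⟩).2) := by
    simp [adjBits, encodingGraphFin, encodingBitVec]
  rw [h, decide_eq_true_iff, finProdFinEquiv_symm_apply]
  rfl

/-- **Clearing the code clears the matrix**: on the code of `Gr x`, `clearStr` yields the code of
the graph of `x` with its header block zeroed. [folklore] -/
theorem clearStr_adjBits (t : ℕ) (x : Fin m × Fin m → Bool) :
    clearStr m t (adjBits (Gr x)) = adjBits (Gr (ovw t (fun _ => false) x)) := by
  apply List.ext_getElem
  · simp [clearStr]
  · intro k h1 h2
    simp only [clearStr, List.getElem_mapIdx, clearBit]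
    have h1' : k < (adjBits (Gr x)).length := by simpa [clearStr] using h1
    rw [Bool.eq_iff_iff]
    simp only [Bool.and_eq_true, Bool.not_eq_true', Bool.and_eq_false_iff, decide_eq_false_iff_not,
      adjBits_getElem _ h1', adjBits_getElem _ h2, gr_adj, ovw]
    by_cases hc : k / m < t ∧ k % m < t
    · simp [hc]
    · have hc' : ¬ (k % m < t ∧ k / m < t) := fun h' => hc ⟨h'.2, h'.1⟩
      simp only [hc, hc', if_false]
      tauto

section Header

variable {t : ℕ}

/-- Header bits are invariant under a header-fixing relabelling: bit `k < t ≤ m` of the code of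
`Gr (x ∘ ρ×ρ)` is bit `k` of the code of `Gr x`. [folklore] -/
theorem adjBits_rel_getElem {ρ : Equiv.Perm (Fin m)} (hfix : ∀ i : Fin m, (i : ℕ) < t → ρ i = i)
    (htm : t ≤ m) (x : Fin m × Fin m → Bool) {k : ℕ} (hk : k < t)
    (h1 : k < (adjBits (Gr (rel ρ x))).length) (h2 : k < (adjBits (Gr x)).length) :
    (adjBits (Gr (rel ρ x)))[k] = (adjBits (Gr x))[k] := by
  rw [Bool.eq_iff_iff, adjBits_getElem _ h1, adjBits_getElem _ h2, gr_rel_adj]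
  have hkm : k < m := lt_of_lt_of_le hk htm
  have hdiv : k / m = 0 := Nat.div_eq_of_lt hkm
  have hmod : k % m = k := Nat.mod_eq_of_lt hkm
  have e1 : ρ ⟨k / m, Nat.div_lt_of_lt_mul (by simpa using h2)⟩ =
      ⟨k / m, Nat.div_lt_of_lt_mul (by simpa using h2)⟩ :=
    hfix _ (by simp [hdiv]; omega)
  have e2 : ρ ⟨k % m, Nat.mod_lt _ (Nat.pos_of_ne_zero fun h => by simp [h] at h2)⟩ =
      ⟨k % m, Nat.mod_lt _ (Nat.pos_of_ne_zero fun h => by simp [h] at h2)⟩ :=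
    hfix _ (by simp [hmod]; omega)
  rw [e1, e2]

/-- Header bits of an overwritten matrix: bit `0 < k < t ≤ m` of the code of
`Gr (ovw t (hdrOf Q) z)` is `Q k`. [folklore] -/
theorem adjBits_ovw_hdrOf_getElem (htm : t ≤ m) (Q : ℕ → Bool) (z : Fin m × Fin m → Bool) {k : ℕ}
    (hk0 : 0 < k) (hk : k < t) (h1 : k < (adjBits (Gr (ovw t (hdrOf Q) z))).length) :
    (adjBits (Gr (ovw t (hdrOf Q) z)))[k] = Q k := by
  rw [Bool.eq_iff_iff, adjBits_getElem _ h1, gr_adj]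
  have hkm : k < m := lt_of_lt_of_le hk htm
  have hdiv : k / m = 0 := Nat.div_eq_of_lt hkm
  have hmod : k % m = k := Nat.mod_eq_of_lt hkm
  have ht0 : 0 < t := lt_of_le_of_lt (Nat.zero_le _) hk
  simp only [ovw, hdrOf, hdiv, hmod, ht0, hk, and_self, if_true, Nat.ne_of_gt hk0, if_false,
    Bool.false_eq_true, or_false, ne_eq, Fin.mk.injEq]
  simp [Nat.ne_of_lt hk0]

end Header

/-! ### The decision map and its language -/

/-- The address width `A·|bin m| + B`. [folklore] -/
def aw (A B m : ℕ) : ℕ := A * (encodeNat m).length + B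

/-- The header size `t m = aw + 2` (one unused diagonal slot, one type bit, `aw` address bits).
[folklore] -/
def hdr (A B m : ℕ) : ℕ := aw A B m + 2

/-- The query type bit: position `1` of the adjacency vector (the edge `{0,1}`). [folklore] -/
def qType (bits : List Bool) : Bool := bits.getD 1 false

/-- The address field: positions `2, …, n + 1` of the adjacency vector. [folklore] -/
def qAddrBits (n : ℕ) (bits : List Bool) : List Bool := (bits.drop 2).take n

/-- The address, a binary numeral (least significant bit first). [folklore] -/
def qAddr (n : ℕ) (bits : List Bool) : ℕ := bitsToNat (qAddrBits n bits)

/-- The answer to a query `(ty, a)` on a string `u`: type `0` asks `a < |u|`, type `1` asks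
`a < |u| ∧ u[a] = 1`. [folklore] -/
def answer (ty : Bool) (a : ℕ) (u : List Bool) : Bool :=
  decide (a < u.length) && (!ty || u.getD a false)

/-- The decision map on a parsed input `(m, bits)`. [folklore] -/
def dec (F : List Bool → List Bool) (A B m₁ : ℕ) (p : ℕ × List Bool) : Bool :=
  !decide (p.1 < m₁) &&
    answer (qType p.2) (qAddr (aw A B p.1) p.2)
      (F (boolPair (encodeNat p.1) (clearStr p.1 (hdr A B p.1) p.2)))

/-- The decision map on an arbitrary string (first field read as a binary numeral). [folklore] -/
def pFun (F : List Bool → List Bool) (A B m₁ : ℕ) (w : List Bool) : Bool :=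
  dec F A B m₁ (bitsToNat (Brick.fstF w), Brick.sndF w)

/-- The language `{w | pFun F A B m₁ w = 1}`. [folklore] -/
def lang (F : List Bool → List Bool) (A B m₁ : ℕ) : Language Bool :=
  {w | pFun F A B m₁ w = true}

section FPPart

open Literature.Computability.Complexity.CodeFP

/-- `clearBit` on codes (`natDiv`, `natMod`, `natLt`). [folklore] -/
theorem codeFP_clearBit :
    CodeFP (pairE (pairE natE natE) (pairE natE bitE)) bitE
      (fun t => clearBit t.1.1 t.1.2 t.2.1 t.2.2) := by
  have hm : CodeFP (pairE (pairE natE natE) (pairE natE bitE)) natE (fun t => t.1.1) := (fst _ _).fst'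
  have ht : CodeFP (pairE (pairE natE natE) (pairE natE bitE)) natE (fun t => t.1.2) := (fst _ _).snd'
  have hi : CodeFP (pairE (pairE natE natE) (pairE natE bitE)) natE (fun t => t.2.1) := (snd _ _).fst'
  have hb : CodeFP (pairE (pairE natE natE) (pairE natE bitE)) bitE (fun t => t.2.2) := (snd _ _).snd'
  exact hb.and ((natLt.comp ((natDiv.comp (hi.pair hm)).pair ht)).and
    (natLt.comp ((natMod.comp (hi.pair hm)).pair ht))).not

/-- `clearStr` on codes (`explode_code`, `mapIdx`, `bitsToStr`). [folklore] -/
theorem codeFP_clearStr :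
    CodeFP (pairE (pairE natE natE) strE) strE (fun p => clearStr p.1.1 p.1.2 p.2) :=
  (bitsToStr.comp ((mapIdx codeFP_clearBit).comp
    ((fst _ _).pair (MachineA.explode_code.comp (snd _ _))))).congr fun _ => rfl

/-- `aw` in unary. [folklore] -/
theorem codeFP_aw (A B : ℕ) : CodeFP natE unE (aw A B) :=
  (unAdd.comp ((((unMulConst A).comp (strLength.comp strOfNat))).pair (const natE B))).congr
    fun _ => rfl

/-- `hdr` in binary. [folklore] -/
theorem codeFP_hdr (A B : ℕ) : CodeFP natE natE (hdr A B) :=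
  (natOfUn.comp (unAdd.comp ((codeFP_aw A B).pair (const natE 2)))).congr fun _ => rfl

/-- `qType` on codes. [folklore] -/
theorem codeFP_qType : CodeFP strE bitE qType :=
  (strGetD.comp ((const strE 1).pair (CodeFP.id strE))).congr fun _ => rfl

/-- `qAddr` on codes. [folklore] -/
theorem codeFP_qAddr : CodeFP (pairE unE strE) natE (fun p => qAddr p.1 p.2) :=
  (strVal.comp (strTake.comp ((fst _ _).pair (strDrop.comp ((const _ 2).pair (snd _ _)))))).congr
    fun _ => rfl

/-- `answer` on codes. [folklore] -/
theorem codeFP_answer :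
    CodeFP (pairE bitE (pairE natE strE)) bitE (fun t => answer t.1 t.2.1 t.2.2) :=
  ((natLt.comp ((snd _ _).fst'.pair (strNatLength.comp (snd _ _).snd'))).and
    ((fst _ _).not.or (strGetDNat.comp ((snd _ _).snd'.pair (snd _ _).fst')))).congr fun _ => rfl

variable {F : List Bool → List Bool}

/-- `dec` on codes. [cite: AroraBarakCC2009, §1.3] -/
theorem codeFP_dec (hF : F ∈ FP) (A B m₁ : ℕ) : CodeFP (pairE natE strE) bitE (dec F A B m₁) := by
  have hFc : CodeFP strE strE F := of_fn F hF fun _ => rfl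
  have hcode : CodeFP (pairE natE strE) strE (fun p => boolPair (encodeNat p.1) p.2) :=
    transparent fun _ => rfl
  have hu : CodeFP (pairE natE strE) strE
      (fun p => F (boolPair (encodeNat p.1) (clearStr p.1 (hdr A B p.1) p.2))) :=
    hFc.comp (hcode.comp ((fst _ _).pair (codeFP_clearStr.comp
      (((fst _ _).pair ((codeFP_hdr A B).comp (fst _ _))).pair (snd _ _)))))
  exact ((natLt.comp ((fst _ _).pair (const _ m₁))).not.and (codeFP_answer.comp
    ((codeFP_qType.comp (snd _ _)).pair ((codeFP_qAddr.comp (((codeFP_aw A B).comp (fst _ _)).pair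
      (snd _ _))).pair hu)))).congr fun _ => rfl

/-- `pFun` on codes (after the parser `codeFP_hdrBody`). [folklore] -/
theorem codeFP_pFun (hF : F ∈ FP) (A B m₁ : ℕ) : CodeFP strE bitE (pFun F A B m₁) :=
  ((codeFP_dec hF A B m₁).comp codeFP_hdrBody).congr fun _ => rfl

/-- **The language is in `P`** (`mem_P_of_mem_FP`). [cite: AroraBarakCC2009, Def. 1.13] -/
theorem lang_mem_P (hF : F ∈ FP) (A B m₁ : ℕ) : lang F A B m₁ ∈ Classes.P := by
  obtain ⟨f, hf, hfp⟩ := codeFP_pFun hF A B m₁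
  refine mem_P_of_mem_FP hf _ fun w => ⟨fun hw => ?_, fun hw => ?_⟩
  · rw [show f w = bitE (pFun F A B m₁ w) from hfp w, show pFun F A B m₁ w = true from hw]; rfl
  · rw [show f w = bitE (pFun F A B m₁ w) from hfp w, Bool.eq_false_iff.2 hw]; rfl

/-- **Registered sub-goal of S2 (`stub_addressableBitLanguage_memP`)**: for every `F ∈ FP` and all
parameters `A B m₁`, the header-addressing language `lang F A B m₁` is in `P` — the
polynomial-time half of stub S2, closed form of `lang_mem_P`. [cite: AroraBarakCC2009, Def. 1.13] -/
theorem stub_addressableBitLanguage_memP : ∀ F ∈ FP, ∀ A B m₁ : ℕ, lang F A B m₁ ∈ Classes.P :=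
  fun _ hF A B m₁ => lang_mem_P hF A B m₁

end FPPart

end Summit.PneNP.PneNP.Theorems.AddressableBitLanguage
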